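import Literature.NumberTheory.EllipticCurves.IwasawaAlgebraProofs
import Literature.Algebra.Module.PadicIntStructure
import Literature.NumberTheory.EllipticCurves.SelmerCorankControlCoinvariantsProofs
import Literature.NumberTheory.EllipticCurves.IwasawaEulerCharDualityProofs
import HarnessLib

/-!
# `μ = 0` and no finite `Λ`-submodule ⟹ `ℤ_p`-free of rank `λ` and `#(M/𝔭M) = p^λ`; and
# `#(X/pX) = #B[p]` for a Pontryagin dual `X ≅ Hom(B, ℚ/ℤ)` — the GENERIC algebra behind the two
# folklore inputs (L1)/(L2) of the Route-G budget schema (cell `b2b-bsdres`, team n1011, seat p12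
# (gen 3); row T-E3gX3-bud-L1/L2; consumers: `Additive/CongruentPartnerBudgetSchemaHolds.lean`, which
# discharges cc-typer-2's typed inputs `card_quotient_eq_pow_lambdaInvariant` and
# `card_quotient_eq_card_selmer_torsion` of `Additive/CongruentPartnerBudgetSchema.lean` BY NAME)

HONEST FRAMING (cell `b2b-bsdres`, run/shared/lean/b2b/bsd-rank1-residual/, verbatim in every
file): the goal of the cell is to DELETE the COMBINATION-SHAPED residual classes of the
Birch–Swinnerton-Dyer formula for ALL analytic-rank `≤ 1` elliptic curves over `ℚ` — "full BSD
formula for every rank `≤ 1` curve in class `C`" assembled STRICTLY from published theorems — so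
that the rank-`≤ 1` remainder becomes exactly the CONSTRUCTION-SHAPED classes, which are TYPED
(missing-input `Prop`s), NOT attempted. This is not "finishing BSD". THIS FILE is pure commutative /
Pontryagin algebra over the Iwasawa algebra `Λ = ℤ_p⟦T⟧` (Mathlib + the tree's
`muInvariant_eq_zero_iff_finite`, `ModN`, `PontryaginCard.natCard_characterModule`): NO elliptic-curve
input, NO named fact, NO definition, nothing booked, no label / mark touched.

## The arguments (Washington §13.2 after Thm. 13.12; Greenberg LNM 1716 §1 p. 60)

(L1-algebra) Let `M` be a `Λ`-module, f.g. over `ℤ_p` (for f.g. torsion `Λ`-modules this is `μ = 0`,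
`muInvariant_eq_zero_iff_finite`). For `c ∈ ℤ_p ∖ 0` the kernel `M[c]` of multiplication by `c` is a
`Λ`-SUBMODULE, f.g. over `ℤ_p` and a module over the FINITE ring `ℤ_p/(c) = ℤ_p/(p^k)`, hence FINITE
(`finite_torsionBy_C`, with the tree's `PadicInt.finite_quotient_span_singleton`); so "no nonzero finite `Λ`-submodule" forces `M[c] = 0`: `M` is
`ℤ_p`-torsion-free (`noZeroSMulDivisors_of_forall_finite_eq_bot`), hence FREE (PID); `λ(M) = dim_{ℚ_p}
ℚ_p ⊗ M = rank_{ℤ_p} M` (`lambdaInvariant_eq_finrank_of_free`); `M/pM ≅ 𝔽_p ⊗ M` has `p^{rank}`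
elements (`natCard_quotient_span_p_smul_top`), and `𝔭M = pM` (`restrictScalars_augIdealP_smul_top`).
(L2-algebra) For ANY abelian group `B`, restriction of characters `Hom(B, ℚ/ℤ)/p → Hom(B[p], ℚ/ℤ)` is a
BIJECTION (`exists_restrictModN_bijective`; both halves by injectivity of `ℚ/ℤ`), so
`#(Hom(B, ℚ/ℤ)/p) = #B[p]` unconditionally (`natCard_modN_characterModule_eq`); and for a `Λ`-module
`X`, `𝔭X = pX` since `C p ∈ Λ` is the integer `p` (`natCard_quotient_augIdealP_smul_top_eq_natCard_modN`).

References: L. Washington, *Introduction to Cyclotomic Fields*, GTM 83 (1997) §13.2, Prop. 13.8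
[Washington1997]; R. Greenberg, LNM 1716 (1999) §1 p. 60 [GreenbergLNM1716]; J. Neukirch, A. Schmidt,
K. Wingberg (2008) Ch. V §3 [NeukirchSchmidtWingberg2008].
-/

set_option autoImplicit false

noncomputable section

open scoped Classical AddSubgroup

open Literature.NumberTheory.EllipticCurves IwasawaAlgebra

namespace Summit.BirchSwinnertonDyer.Rank1Residual.Iwasawa

universe u

/-! ### §1 Generic algebra over `Λ = ℤ_p⟦T⟧`: `μ = 0`-shape modules -/

section Generic

variable (p : ℕ) [hp : Fact p.Prime]

variable {M : Type u} [AddCommGroup M] [Module (IwasawaAlgebra p) M] [Module ℤ_[p] M]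
  [IsScalarTower ℤ_[p] (IwasawaAlgebra p) M]

/-- The scalar `c ∈ ℤ_p` acts on a `Λ`-module through the constant power series `C c`. [folklore] -/
theorem C_smul_eq_smul (c : ℤ_[p]) (m : M) : (PowerSeries.C c : IwasawaAlgebra p) • m = c • m := by
  rw [← PowerSeries.algebraMap_eq, algebraMap_smul]

/-- **The `c`-torsion of a `Λ`-module that is finitely generated over `ℤ_p` is FINITE** (`c ≠ 0`): the
kernel `M[C c]` of multiplication by the constant `c` is a `Λ`-submodule, finitely generated over
`ℤ_p` (Noetherian) and a module over the finite ring `ℤ_p/(c)`. [cite: Washington1997, §13.2 (after Thm. 13.12)] -/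
theorem finite_torsionBy_C [Module.Finite ℤ_[p] M] {c : ℤ_[p]} (hc : c ≠ 0) :
    Finite (Submodule.torsionBy (IwasawaAlgebra p) M (PowerSeries.C c)) := by
  set N : Submodule (IwasawaAlgebra p) M := Submodule.torsionBy (IwasawaAlgebra p) M (PowerSeries.C c)
  let N' : Submodule ℤ_[p] M := N.restrictScalars ℤ_[p]
  -- `N'` is f.g. over `ℤ_p` and killed by `c`
  have hN' : Module.IsTorsionBySet ℤ_[p] N' (Ideal.span {c}) := by
    rw [Module.isTorsionBySet_span_singleton_iff]
    intro x
    apply Subtype.ext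
    change c • (x : M) = 0
    rw [← C_smul_eq_smul p c (x : M)]
    exact (Submodule.mem_torsionBy_iff _ _).mp x.2
  letI := hN'.module
  haveI : Module.Finite (ℤ_[p] ⧸ Ideal.span {c}) N' :=
    Module.Finite.of_restrictScalars_finite ℤ_[p] _ _
  haveI : Finite (ℤ_[p] ⧸ Ideal.span {c}) := Literature.Algebra.Module.PadicInt.finite_quotient_span_singleton p hc
  have hfin : Finite N' := Module.finite_of_finite (ℤ_[p] ⧸ Ideal.span {c})
  exact Finite.of_equiv N' (Equiv.subtypeEquivRight fun _ ↦ Iff.rfl)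

/-- **No nonzero finite `Λ`-submodule ⟹ `ℤ_p`-torsion-free** (for `M` finitely generated over `ℤ_p`):
if `c • m = 0` with `c ≠ 0` then `m` lies in the finite `Λ`-submodule `M[C c]`, which is `⊥`.
[cite: Washington1997, §13.2 (after Thm. 13.12)] -/
theorem noZeroSMulDivisors_of_forall_finite_eq_bot [Module.Finite ℤ_[p] M]
    (hnf : ∀ N : Submodule (IwasawaAlgebra p) M, Finite N → N = ⊥) : NoZeroSMulDivisors ℤ_[p] M := by
  refine ⟨fun {c m} h ↦ ?_⟩
  by_contra hne
  obtain ⟨hc, hm⟩ := not_or.mp hne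
  have hbot := hnf _ (finite_torsionBy_C p (M := M) hc)
  have hmN : m ∈ Submodule.torsionBy (IwasawaAlgebra p) M (PowerSeries.C c) := by
    rw [Submodule.mem_torsionBy_iff, C_smul_eq_smul]
    exact h
  rw [hbot, Submodule.mem_bot] at hmN
  exact hm hmN

/-- **`μ = 0`-shape + no nonzero finite `Λ`-submodule ⟹ `ℤ_p`-FREE** (f.g. torsion-free over the PID
`ℤ_p`). [cite: Washington1997, §13.2 (after Thm. 13.12)] -/
theorem free_of_forall_finite_eq_bot [Module.Finite ℤ_[p] M]
    (hnf : ∀ N : Submodule (IwasawaAlgebra p) M, Finite N → N = ⊥) : Module.Free ℤ_[p] M := by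
  haveI := noZeroSMulDivisors_of_forall_finite_eq_bot p (M := M) hnf
  exact Module.free_of_finite_type_torsion_free'

omit [Module (IwasawaAlgebra p) M] [IsScalarTower ℤ_[p] (IwasawaAlgebra p) M] in
/-- **`#(V/pV) = p^{rank_{ℤ_p} V}` for a finitely generated free `ℤ_p`-module `V`**:
`V/pV ≅ 𝔽_p ⊗_{ℤ_p} V` is an `𝔽_p`-vector space of dimension `rank_{ℤ_p} V`. [folklore] -/
theorem natCard_quotient_span_p_smul_top [Module.Finite ℤ_[p] M] [Module.Free ℤ_[p] M] :
    Nat.card (M ⧸ (Ideal.span {(p : ℤ_[p])} • (⊤ : Submodule ℤ_[p] M))) =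
      p ^ Module.finrank ℤ_[p] M := by
  set I : Ideal ℤ_[p] := Ideal.span {(p : ℤ_[p])} with hI
  have hIm : I = IsLocalRing.maximalIdeal ℤ_[p] := by rw [hI, PadicInt.maximalIdeal_eq_span_p]
  haveI : I.IsMaximal := by rw [hIm]; exact IsLocalRing.maximalIdeal.isMaximal ℤ_[p]
  letI : Field (ℤ_[p] ⧸ I) := Ideal.Quotient.field I
  have hK : Nat.card (ℤ_[p] ⧸ I) = p := by
    have hker : I = RingHom.ker (PadicInt.toZMod (p := p)) := by rw [PadicInt.ker_toZMod, hIm]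
    rw [Nat.card_congr ((Ideal.quotEquivOfEq hker).trans (RingHom.quotientKerEquivOfSurjective
      (ZMod.ringHom_surjective (PadicInt.toZMod (p := p))))).toEquiv, Nat.card_zmod]
  rw [← Nat.card_congr (TensorProduct.quotTensorEquivQuotSMul M I).toEquiv,
    Module.natCard_eq_pow_finrank (K := ℤ_[p] ⧸ I), Module.finrank_baseChange, hK]

/-- `𝔭M = pM`: the `Λ`-submodule `(p)·M` and the `ℤ_p`-submodule `p·M` have the same carrier (for any
compatible `ℤ_p`-structure, `IsScalarTower ℤ_p Λ M`). [folklore] -/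
theorem restrictScalars_augIdealP_smul_top :
    (augIdealP p • (⊤ : Submodule (IwasawaAlgebra p) M)).restrictScalars ℤ_[p] =
      Ideal.span {(p : ℤ_[p])} • (⊤ : Submodule ℤ_[p] M) := by
  ext x
  rw [Submodule.restrictScalars_mem, augIdealP, Submodule.ideal_span_singleton_smul,
    Submodule.ideal_span_singleton_smul, Submodule.mem_smul_pointwise_iff_exists,
    Submodule.mem_smul_pointwise_iff_exists]
  constructor
  · rintro ⟨b, -, rfl⟩
    exact ⟨b, Submodule.mem_top, (C_smul_eq_smul p (p : ℤ_[p]) b).symm⟩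
  · rintro ⟨b, -, rfl⟩
    exact ⟨b, Submodule.mem_top, C_smul_eq_smul p (p : ℤ_[p]) b⟩

/-- **`#(M/𝔭M) = p^{rank_{ℤ_p} M}`** for a `Λ`-module that is finitely generated and free over `ℤ_p`
(any compatible `ℤ_p`-structure). [cite: Washington1997, §13.2 (after Thm. 13.12)] -/
theorem natCard_quotient_augIdealP_smul_top_eq_pow_finrank [Module.Finite ℤ_[p] M]
    [Module.Free ℤ_[p] M] :
    Nat.card (M ⧸ (augIdealP p • (⊤ : Submodule (IwasawaAlgebra p) M))) =
      p ^ Module.finrank ℤ_[p] M := by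
  rw [← natCard_quotient_span_p_smul_top p (M := M), ← restrictScalars_augIdealP_smul_top p (M := M)]
  exact Nat.card_congr (Submodule.Quotient.restrictScalarsEquiv ℤ_[p]
    (augIdealP p • (⊤ : Submodule (IwasawaAlgebra p) M))).toEquiv.symm

/-- **`λ(M) = rank_{ℤ_p} M`** for a `Λ`-module whose restricted `ℤ_p`-structure is finitely generated
and free (`λ(M) := dim_{ℚ_p} ℚ_p ⊗_{ℤ_p} M`). [cite: Washington1997, §13.2 and Prop. 13.8] -/
theorem lambdaInvariant_eq_finrank_of_free (M : Type u) [AddCommGroup M] [Module (IwasawaAlgebra p) M]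
    [Module.Finite ℤ_[p] (RestrictScalars ℤ_[p] (IwasawaAlgebra p) M)]
    [Module.Free ℤ_[p] (RestrictScalars ℤ_[p] (IwasawaAlgebra p) M)] :
    lambdaInvariant p M = Module.finrank ℤ_[p] (RestrictScalars ℤ_[p] (IwasawaAlgebra p) M) :=
  Module.finrank_baseChange

end Generic

/-! ### §2 Pontryagin: `Hom(B, ℚ/ℤ)/p ≅ Hom(B[p], ℚ/ℤ)` (bijection, no finiteness proviso) -/

section Pontryagin

variable (p : ℕ) (B : Type u) [AddCommGroup B]

/-- **`Hom(B, ℚ/ℤ)/p ≅ Hom(B[p], ℚ/ℤ)` by RESTRICTION, for every abelian group `B`**: the restriction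
map (well defined: `p·χ` kills `B[p]`) is a BIJECTION — injective (a character killing `B[p]` factors
through `B/B[p] ≅ pB` and the induced character of `pB` extends to `B`, so it is `p` times a
character) and surjective (characters of the subgroup `B[p]` extend), both by injectivity of `ℚ/ℤ`
(`CharacterModule.dual_surjective_of_injective`). The two halves are the maps of the tree's
`natCard_modN_characterModule_le` / `natCard_characterModule_torsionBy_le`, here WITHOUT finiteness
provisos; stated as an existence so that no definition is introduced. [folklore] -/
theorem exists_restrictModN_bijective :
    ∃ r : ModN (CharacterModule B) p →+ CharacterModule (B[(p : ℤ)]),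
      (∀ (χ : CharacterModule B) (b : B[(p : ℤ)]), r (ModN.mkQ p χ) b = χ b) ∧
        Function.Bijective r := by
  let r : ModN (CharacterModule B) p →+ CharacterModule (B[(p : ℤ)]) :=
    ModN.liftEquiv.symm
      ⟨(CharacterModule.dual ((B[(p : ℤ)]).subtype.toIntLinearMap)).toAddMonoidHom, fun χ ↦ by
        refine AddMonoidHom.ext fun b ↦ ?_
        show p • χ (b : B) = 0
        rw [← map_nsmul, ← AddSubgroupClass.coe_nsmul, AddSubgroup.torsionBy.nsmul b,
          ZeroMemClass.coe_zero, map_zero]⟩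
  have hr : ∀ (χ : CharacterModule B) (b : B[(p : ℤ)]), r (ModN.mkQ p χ) b = χ b := fun _ _ ↦ rfl
  refine ⟨r, hr, ?_, ?_⟩
  · rw [injective_iff_map_eq_zero]
    intro q hq
    obtain ⟨χ, rfl⟩ := Submodule.mkQ_surjective _ q
    change r (ModN.mkQ p χ) = 0 at hq
    -- `χ` kills `B[p]`, the kernel of multiplication by `p`
    have hχ : ∀ b : B, p • b = 0 → χ b = 0 := fun b hb ↦ by
      rw [← hr χ ⟨b, AddSubgroup.torsionBy.nsmul_iff.mpr hb⟩, hq]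
      rfl
    let m : B →+ B := nsmulAddMonoidHom p
    have hm : ∀ b, m b = p • b := fun _ ↦ rfl
    have hker : m.rangeRestrict.ker ≤ χ.ker := fun b hb ↦ by
      rw [AddMonoidHom.mem_ker] at hb ⊢
      exact hχ b (by rw [← hm]; exact congrArg (fun z : m.range ↦ (z : B)) hb)
    -- factor `χ` through `pB` and extend
    let χ' : m.range →+ AddCircle (1 : ℚ) :=
      m.rangeRestrict.liftOfSurjective (AddMonoidHom.rangeRestrict_surjective m) ⟨χ, hker⟩
    have hχ' : ∀ b, χ' (m.rangeRestrict b) = χ b := fun b ↦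
      AddMonoidHom.liftOfRightInverse_comp_apply _ _ _ _ b
    obtain ⟨ψ, hψ⟩ := CharacterModule.dual_surjective_of_injective
      (m.range.subtype.toIntLinearMap) (fun a b hab ↦ Subtype.ext hab) χ'
    have hψ' : ∀ g : m.range, ψ g = χ' g := fun g ↦ by
      have := DFunLike.congr_fun hψ g
      rw [CharacterModule.dual_apply] at this
      exact this
    -- `χ = p • ψ`
    change ModN.mkQ p χ = 0
    rw [ZpCorank.modN_mkQ_eq_zero_iff]
    refine ⟨ψ, ?_⟩
    rw [LinearMap.lsmul_apply]
    refine CharacterModule.ext (A := B) fun b ↦ ?_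
    change (p : ℤ) • ψ b = χ b
    rw [← hχ' b, ← hψ', ← map_zsmul ψ]
    congr 1
    rw [AddMonoidHom.coe_rangeRestrict, hm, natCast_zsmul]
  · intro φ
    obtain ⟨χ, hχ⟩ := CharacterModule.dual_surjective_of_injective
      ((B[(p : ℤ)]).subtype.toIntLinearMap) (fun a b h ↦ Subtype.ext h) φ
    refine ⟨ModN.mkQ p χ, CharacterModule.ext (A := B[(p : ℤ)]) fun b ↦ ?_⟩
    rw [hr, ← hχ]
    rfl

/-- **`#(Hom(B, ℚ/ℤ)/p) = #B[p]`** for every abelian group `B`, UNCONDITIONALLY (`Nat.card`; both sides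
`0` when `B[p]` is infinite): the restriction bijection (`exists_restrictModN_bijective`) and `#Hom(A, ℚ/ℤ) = #A`
(`natCard_characterModule`). [folklore] -/
theorem natCard_modN_characterModule_eq :
    Nat.card (ModN (CharacterModule B) p) = Nat.card (B[(p : ℤ)]) := by
  obtain ⟨r, -, hr⟩ := exists_restrictModN_bijective p B
  rw [Nat.card_eq_of_bijective _ hr, PontryaginCard.natCard_characterModule]

end Pontryagin

/-! ### §3 `X/𝔭X = X/pX` for a `Λ`-module -/

section ModP

variable (p : ℕ) [hp : Fact p.Prime] {X : Type u} [AddCommGroup X] [Module (IwasawaAlgebra p) X]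

/-- `𝔭X = pX`: the constant `C p ∈ Λ` is the integer `p`, so the `Λ`-submodule `(p)·X` and the subgroup
`p·X` (`ModN`'s `range (lsmul ℤ X p)`) coincide. [folklore] -/
theorem restrictScalars_int_augIdealP_smul_top :
    (augIdealP p • (⊤ : Submodule (IwasawaAlgebra p) X)).restrictScalars ℤ =
      LinearMap.range (LinearMap.lsmul ℤ X p) := by
  ext x
  rw [Submodule.restrictScalars_mem, augIdealP, Submodule.ideal_span_singleton_smul,
    Submodule.mem_smul_pointwise_iff_exists, LinearMap.mem_range]
  have hC : (PowerSeries.C (p : ℤ_[p]) : IwasawaAlgebra p) = (p : IwasawaAlgebra p) := map_natCast _ p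
  constructor
  · rintro ⟨b, -, rfl⟩
    refine ⟨b, ?_⟩
    rw [LinearMap.lsmul_apply, hC, Nat.cast_smul_eq_nsmul, Nat.cast_smul_eq_nsmul]
  · rintro ⟨b, rfl⟩
    refine ⟨b, Submodule.mem_top, ?_⟩
    rw [LinearMap.lsmul_apply, hC, Nat.cast_smul_eq_nsmul, Nat.cast_smul_eq_nsmul]

/-- **`#(X/𝔭X) = #(X/pX)`** (`X/pX = ModN X p`). [folklore] -/
theorem natCard_quotient_augIdealP_smul_top_eq_natCard_modN :
    Nat.card (X ⧸ (augIdealP p • (⊤ : Submodule (IwasawaAlgebra p) X))) = Nat.card (ModN X p) := by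
  rw [← Nat.card_congr (Submodule.Quotient.restrictScalarsEquiv ℤ
    (augIdealP p • (⊤ : Submodule (IwasawaAlgebra p) X))).toEquiv]
  exact Nat.card_congr (Submodule.quotEquivOfEq _ _ (restrictScalars_int_augIdealP_smul_top p)).toEquiv

end ModP

end Summit.BirchSwinnertonDyer.Rank1Residual.Iwasawa

end
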